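import Mathlib.Algebra.BigOperators.Field
import Literature.Computability.AlgebraicComplexity.RelativeRank
import Literature.Computability.AlgebraicComplexity.NewtonSetMultilinear
import Literature.Computability.AlgebraicComplexity.CircuitGateSemantics
import Literature.Computability.AlgebraicComplexity.WordAutomaton
import HarnessLib

/-!
# The rank of low product-depth circuits on the word blocks (LST 2025, Claim 16, semantic form)

(N. Limaye, S. Srinivasan, S. Tavenas, J. ACM 72 (2025), Art. 26 = FOCS 2021, §5: Lemma 15,
Claim 16 — "any set-multilinear formula `C` of product depth `Δ` of size at most `s` satisfies
`relrk_w(C) ≤ s · 2^{-k d^{1/(2^Δ-1)}/20}`" — combined with Prop. 9 / Lemmas 12, 19, 20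
(homogenisation and set-multilinearisation), run directly on the values of the gates of an
arbitrary circuit.)

Setting: a word (`pos : Fin d → Bool`, `k`; blocks `X i = LSTWord.BlockVar k pos i` with
`2^{|w_i|}` variables, `UnbiasedWords.lean` / `WordAutomaton.lean`), a field `K` of
characteristic `0`, a circuit `P` over any finite variable type `σ₀` and a *block-preserving*
substitution `g : σ₀ → K[X(w)]` (each variable of `P` goes to a block-linear form), and the
measure `ν_T(f) = relRank K pos T f` of `RelativeRank.lean`.

**Main theorem** (`relRank_aeval_eval_le`): if `10 d ≤ k` and `P` has `s` gates, `N = |σ₀|`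
variables and product-depth `≤ Δ`, then `ν_{[d]}(g(P)) ≤ Λ_Δ · 2^{-k d^{μ_Δ}/20}`, where
`μ_0 = 1`, `μ_{p+1} = μ_p/(4 + 3 μ_p)` and `Λ_Δ = (stepConst s N d)^Δ (N + 1)` with
`stepConst s N d = (s+1)(s+N+1)(d+1)^{5d+1} + 2N + 2`.

## The induction (LST's proof of Claim 16, reorganised; see the module docstrings of
`NewtonSetMultilinear.lean` and `CircuitGateSemantics.lean`)

`IH p`: every value `x` of a gate of product-depth `≤ p` (and every leaf `g v`, `C c`) satisfies
`ν_T(x) ≤ Λ_p Φ_p(#T)` for all nonempty `T`, `Φ_p(m) = 2^{-k m^{μ_p}/20}`.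
* `p = 0`: such gates are affine in the block-linear forms `g v` (sum closure with no product
  gates), and `ν_T(g v) = 0` unless `T = {blk v}`, where the imbalance bound gives
  `2^{-|w_T|/2} ≤ 2^{-k/20}`.
* Product gate of product-depth `p + 1` with operand values `L` (a list, repetitions allowed):
  by `NewtonSetMultilinear`, `smlProj T (L.prod)` is `0` or a combination of `≤ (m+1)^{4m+1}`
  structured generators, each a product over a labelled partition of `T` of projections of
  operand values and of power sums `newtonPow L i`; `ν_T` of a generator is the product of the
  `ν` of its factors (`relRank_finset_prod`). With thresholds `θ_A = m^a ≥ θ_B = m^b`: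
  (A1) a large operand part is bounded by `IH p`; (A2) a large power-sum part is bounded, after
  DE-DUPLICATING the operand values (at most `s + N` non-constant ones; constants contribute
  `0`), by a second-level analysis (B1)/(B2) of the products `∏ smlProj (part) x`; (A3) if all
  parts are small, the imbalance of small block sets (`|w_W| ≥ k/(5#W) - #W`, Claim 17) makes the
  product tiny. The exponents `a = (1-μ')/2`, `b = (1-3μ')/4`, `μ' = μ/(4+3μ)` equalise the
  three cases to `k m^{μ'}/20`.
* Sum gates: sum closure (`gateVal_mem_span_spanFamily`) costs a factor `s` (+ leaves).

## References

* N. Limaye, S. Srinivasan, S. Tavenas, J. ACM 72 (2025), Art. 26, §5, Lemma 15, Claim 16,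
  Claim 17 (pp. 26:13–26:15); Prop. 9, Lemmas 12, 19, 20.
-/

noncomputable section

open MvPolynomial Finsupp

namespace Literature.Computability.AlgebraicComplexity

namespace LSTWord

universe u

section Imbalance

variable {K : Type u} [Field K] {d : ℕ} (k : ℕ) (pos : Fin d → Bool)

/-! ### Imbalance in terms of the word -/

/-- The size of a block of variables: `|X i| = 2^{|w_i|}`.
[cite: LimayeSrinivasanTavenas2025, §2] -/
theorem card_blockVar (i : Fin d) : Fintype.card (BlockVar k pos i) = 2 ^ letterSize k pos i := by
  rw [Fintype.card_fun, Fintype.card_bool, Fintype.card_fin]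

/-- `|M^P|` over the blocks `T`: `∏_{i ∈ T⁺} |X i| = 2^{#T⁺ ⌊k/√2⌋}`.
[cite: LimayeSrinivasanTavenas2025, §2.1] -/
theorem prod_card_filter_pos (T : Finset (Fin d)) :
    (∏ i ∈ T.filter (fun i => pos i), (Fintype.card (BlockVar k pos i) : ℝ)) =
      (2 : ℝ) ^ ((T.filter fun i => pos i).card * posLetter k) := by
  have hfac : ∀ i ∈ T.filter (fun i => pos i),
      (Fintype.card (BlockVar k pos i) : ℝ) = (2 : ℝ) ^ posLetter k := by
    intro i hi
    rw [Finset.mem_filter] at hi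
    rw [card_blockVar, letterSize, if_pos hi.2]
    push_cast
    rfl
  rw [Finset.prod_congr rfl hfac, Finset.prod_const, ← pow_mul, mul_comm]

/-- `|M^N|` over the blocks `T`: `∏_{i ∈ T⁻} |X i| = 2^{#T⁻ k}`.
[cite: LimayeSrinivasanTavenas2025, §2.1] -/
theorem prod_card_filter_neg (T : Finset (Fin d)) :
    (∏ i ∈ T.filter (fun i => !pos i), (Fintype.card (BlockVar k pos i) : ℝ)) =
      (2 : ℝ) ^ ((T.filter fun i => !pos i).card * k) := by
  have hfac : ∀ i ∈ T.filter (fun i => !pos i),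
      (Fintype.card (BlockVar k pos i) : ℝ) = (2 : ℝ) ^ k := by
    intro i hi
    rw [Finset.mem_filter] at hi
    have : ¬ pos i = true := by simpa using hi.2
    rw [card_blockVar, letterSize, if_neg this]
    push_cast
    rfl
  rw [Finset.prod_congr rfl hfac, Finset.prod_const, ← pow_mul, mul_comm]

/-- **Imbalance** (LST 2025, Claim 7(1) in word form): `relrk_{w|T}(f) ≤ 2^{-|w_T|/2}` for
every `f` and every block set `T`. [cite: LimayeSrinivasanTavenas2025, Claim 7] -/
theorem relRank_le_two_pow_wsum (T : Finset (Fin d)) (f : MvPolynomial (Σ i, BlockVar k pos i) K) :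
    relRank K pos T f ≤ (2 : ℝ) ^ (-(|(wsum k pos T : ℝ)|) / 2) := by
  have h2 : (0 : ℝ) < 2 := by norm_num
  set p := (T.filter fun i => pos i).card
  set q := (T.filter fun i => !pos i).card
  have hw : (wsum k pos T : ℝ) = p * posLetter k - q * k := by
    rw [wsum_eq_card_sub_card]; push_cast; rfl
  have hR := prod_card_filter_pos k pos T
  have hC := prod_card_filter_neg k pos T
  have hpow : (2 : ℝ) ^ (p * posLetter k) / (2 : ℝ) ^ (q * k) = (2 : ℝ) ^ (wsum k pos T : ℝ) := by
    rw [hw, Real.rpow_sub h2,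
      show ((p : ℝ) * (posLetter k : ℝ)) = ((p * posLetter k : ℕ) : ℝ) by push_cast; ring,
      show ((q : ℝ) * (k : ℝ)) = ((q * k : ℕ) : ℝ) by push_cast; ring,
      Real.rpow_natCast, Real.rpow_natCast]
  have hsqrt : ∀ x : ℝ, Real.sqrt ((2 : ℝ) ^ x) = (2 : ℝ) ^ (x / 2) := fun x => by
    rw [Real.sqrt_eq_rpow, ← Real.rpow_mul h2.le]
    congr 1; ring
  by_cases hsign : (0 : ℝ) ≤ (wsum k pos T : ℝ)
  · have h := relRank_le_sqrt_div' (K := K) pos T f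
    rw [hR, hC] at h
    have hinv : (2 : ℝ) ^ (q * k) / (2 : ℝ) ^ (p * posLetter k) = (2 : ℝ) ^ (-(wsum k pos T : ℝ)) := by
      rw [Real.rpow_neg h2.le, ← hpow, inv_div]
    rw [hinv, hsqrt] at h
    rw [abs_of_nonneg hsign]
    exact h
  · have h := relRank_le_sqrt_div (K := K) pos T f
    rw [hR, hC, hpow, hsqrt] at h
    rw [abs_of_neg (not_le.1 hsign), neg_neg]
    exact h

/-- A block-linear form has `relrk = 0` over every block set but its own block.
[cite: LimayeSrinivasanTavenas2025, §2.1] -/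
theorem relRank_eq_zero_of_blockLinear {f : MvPolynomial (Σ i, BlockVar k pos i) K} {b : Fin d}
    (hf : IsWeightedHomogeneous (blockWeight Sigma.fst) f (Finsupp.single b 1))
    {T : Finset (Fin d)} (hT : T ≠ {b}) : relRank K pos T f = 0 := by
  refine relRank_eq_zero_of_isSetMultilinear pos ?_ hT
  unfold IsSetMultilinear
  rwa [blockProfile_singleton]

/-- Constants have `relrk = 0` over every nonempty block set.
[cite: LimayeSrinivasanTavenas2025, §2.1] -/
theorem relRank_C_eq_zero (c : K) {T : Finset (Fin d)} (hT : T.Nonempty) :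
    relRank K pos T (C c : MvPolynomial (Σ i, BlockVar k pos i) K) = 0 :=
  relRank_eq_zero_of_isSetMultilinear pos (isSetMultilinear_C Sigma.fst c)
    (Finset.nonempty_iff_ne_empty.1 hT)

/-- **Leaves**: a block-linear form `h` satisfies `relrk_{w|T}(h) ≤ 2^{-k/20}` for every
nonempty `T` as soon as `k ≥ 10` (zero unless `T` is its block, where `|w_T| ≥ k/5 - 1`).
[cite: LimayeSrinivasanTavenas2025, Claim 16] -/
theorem relRank_blockLinear_le {f : MvPolynomial (Σ i, BlockVar k pos i) K} {b : Fin d}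
    (hf : IsWeightedHomogeneous (blockWeight Sigma.fst) f (Finsupp.single b 1))
    {T : Finset (Fin d)} (hk : 10 ≤ k) : relRank K pos T f ≤ (2 : ℝ) ^ (-(k : ℝ) / 20) := by
  by_cases hT : T = {b}
  · refine (relRank_le_two_pow_wsum k pos T f).trans ?_
    refine Real.rpow_le_rpow_of_exponent_le (by norm_num) ?_
    have habs := abs_wsum_ge k pos (S := T) (by rw [hT]; exact Finset.singleton_nonempty b)
    rw [hT, Finset.card_singleton] at habs
    rw [hT]
    have hk' : (10 : ℝ) ≤ k := by exact_mod_cast hk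
    push_cast at habs
    linarith
  · rw [relRank_eq_zero_of_blockLinear k pos hf hT]
    positivity

/-! ### Small block sets are imbalanced -/

/-- For `1 ≤ #W < θ` and `10 θ² ≤ k`: `|w_W| ≥ #W · k/(10 θ²)` (from `|w_W| ≥ k/(5#W) - #W`,
LST 2025, p. 26:15: "the last inequality follows from the fact that `k ≥ 10 T²`").
[cite: LimayeSrinivasanTavenas2025, Claim 16] -/
theorem abs_wsum_ge_linear {W : Finset (Fin d)} {θ : ℝ} (hWθ : (W.card : ℝ) < θ)
    (hk : 10 * θ ^ 2 ≤ k) : (W.card : ℝ) * k / (10 * θ ^ 2) ≤ |(wsum k pos W : ℝ)| := by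
  rcases Finset.eq_empty_or_nonempty W with hW | hW
  · subst hW; simp [wsum]
  · have hc : (1 : ℝ) ≤ W.card := by exact_mod_cast Finset.card_pos.2 hW
    have hθ : 0 < θ := by linarith
    have h1 := abs_wsum_ge k pos hW
    -- `k/(5c) - c ≥ k/(10c)` since `k ≥ 10 c²`, and `k/(10 c) ≥ c k/(10 θ²)` since `c ≤ θ`
    have hcθ : (W.card : ℝ) ^ 2 ≤ θ ^ 2 := by nlinarith
    have hk' : 10 * (W.card : ℝ) ^ 2 ≤ k := le_trans (by nlinarith) hk
    have step1 : (k : ℝ) / (10 * W.card) ≤ (k : ℝ) / (5 * W.card) - W.card := by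
      have hsplit : (k : ℝ) / (5 * W.card) - k / (10 * W.card) = k / (10 * W.card) := by
        field_simp; ring
      have hcc : (W.card : ℝ) ≤ k / (10 * W.card) := by
        rw [le_div_iff₀ (by positivity)]; nlinarith
      linarith
    have step2 : (W.card : ℝ) * k / (10 * θ ^ 2) ≤ (k : ℝ) / (10 * W.card) := by
      rw [div_le_div_iff₀ (by positivity) (by positivity)]
      have hk0 : (0 : ℝ) ≤ k := Nat.cast_nonneg k
      nlinarith [mul_le_mul_of_nonneg_left hcθ hk0]
    linarith

/-- **Products over small parts** (cases "type 2" of LST 2025, proof of Claim 16): if the block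
sets `W x` all have fewer than `θ` elements, `θ ≥ 1`, `10 θ² ≤ k`, then
`∏_x 2^{-|w_{W x}|/2} ≤ 2^{-k (∑_x #W x) / (20 θ²)}`.
[cite: LimayeSrinivasanTavenas2025, Claim 16] -/
theorem prod_two_pow_wsum_le {ι' : Type*} (s : Finset ι') (W : ι' → Finset (Fin d)) {θ : ℝ}
    (hk : 10 * θ ^ 2 ≤ k) (hW : ∀ x ∈ s, ((W x).card : ℝ) < θ) :
    ∏ x ∈ s, (2 : ℝ) ^ (-(|(wsum k pos (W x) : ℝ)|) / 2) ≤
      (2 : ℝ) ^ (-(k : ℝ) * (∑ x ∈ s, ((W x).card : ℝ)) / (20 * θ ^ 2)) := by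
  have h2 : (0 : ℝ) < 2 := by norm_num
  have hrhs : (2 : ℝ) ^ (-(k : ℝ) * (∑ x ∈ s, ((W x).card : ℝ)) / (20 * θ ^ 2)) =
      ∏ x ∈ s, (2 : ℝ) ^ (-(k : ℝ) * ((W x).card : ℝ) / (20 * θ ^ 2)) := by
    rw [← Real.rpow_sum_of_pos h2]
    congr 1
    rw [Finset.mul_sum, Finset.sum_div]
  rw [hrhs]
  refine Finset.prod_le_prod (fun x _ => by positivity) fun x hx => ?_
  refine Real.rpow_le_rpow_of_exponent_le (by norm_num) ?_
  have hθ : 0 < θ := lt_of_le_of_lt (Nat.cast_nonneg _) (hW x hx)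
  have hmain := abs_wsum_ge_linear k pos (hW x hx) hk
  rw [div_le_iff₀ (by positivity)] at hmain
  have hle : (k : ℝ) * ((W x).card : ℝ) / (20 * θ ^ 2) ≤ |(wsum k pos (W x) : ℝ)| / 2 := by
    rw [div_le_div_iff₀ (by positivity) (by norm_num)]
    nlinarith
  have : -(k : ℝ) * ((W x).card : ℝ) / (20 * θ ^ 2) = -((k : ℝ) * ((W x).card : ℝ) / (20 * θ ^ 2)) := by
    ring
  rw [this]
  linarith

end Imbalance

/-! ### The exponents `μ_p` and the bounds `Φ_p` -/

section Exponents

/-- The exponent sequence: `μ_0 = 1`, `μ_{p+1} = μ_p / (4 + 3 μ_p)` (so `μ_1 = 1/7`,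
`μ_2 = 1/31`, …; any positive value would do for the final statement).
[cite: LimayeSrinivasanTavenas2025, Claim 16] -/
def mu : ℕ → ℝ
  | 0 => 1
  | p + 1 => mu p / (4 + 3 * mu p)

/-- `μ_p > 0`. [cite: LimayeSrinivasanTavenas2025, Claim 16] -/
theorem mu_pos (p : ℕ) : 0 < mu p := by
  induction p with
  | zero => simp [mu]
  | succ p ih => simp only [mu]; positivity

/-- `μ_p ≤ 1`. [cite: LimayeSrinivasanTavenas2025, Claim 16] -/
theorem mu_le_one (p : ℕ) : mu p ≤ 1 := by
  induction p with
  | zero => simp [mu]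
  | succ p ih =>
    simp only [mu]
    rw [div_le_one (by have := mu_pos p; positivity)]
    have := mu_pos p; linarith

/-- `μ_{p+1} ≤ μ_p`. [cite: LimayeSrinivasanTavenas2025, Claim 16] -/
theorem mu_succ_le (p : ℕ) : mu (p + 1) ≤ mu p := by
  simp only [mu]
  rw [div_le_iff₀ (by have := mu_pos p; positivity)]
  have := mu_pos p; nlinarith

/-- `μ` is antitone. [cite: LimayeSrinivasanTavenas2025, Claim 16] -/
theorem mu_antitone {p p' : ℕ} (h : p ≤ p') : mu p' ≤ mu p := by
  induction h with
  | refl => exact le_rfl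
  | step _ ih => exact (mu_succ_le _).trans ih

/-- The bound shape `Φ_p(x) = 2^{-k x^{μ_p}/20}`. [cite: LimayeSrinivasanTavenas2025, Claim 16] -/
def Phi (k : ℕ) (p : ℕ) (x : ℝ) : ℝ := (2 : ℝ) ^ (-(k : ℝ) * x ^ mu p / 20)

/-- `Φ > 0`. [folklore] -/
theorem Phi_pos (k p : ℕ) (x : ℝ) : 0 < Phi k p x := by unfold Phi; positivity

/-- `Φ_p` is antitone on `[0, ∞)`. [cite: LimayeSrinivasanTavenas2025, Claim 16] -/
theorem Phi_antitone (k p : ℕ) {x y : ℝ} (hx : 0 ≤ x) (hxy : x ≤ y) : Phi k p y ≤ Phi k p x := by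
  unfold Phi
  refine Real.rpow_le_rpow_of_exponent_le (by norm_num) ?_
  have : x ^ mu p ≤ y ^ mu p := Real.rpow_le_rpow hx hxy (mu_pos p).le
  have hk : (0 : ℝ) ≤ k := Nat.cast_nonneg k
  nlinarith [mul_le_mul_of_nonneg_left this hk]

/-- `Φ_p ≤ Φ_{p'}` for `p ≤ p'` on `[1, ∞)` (smaller exponent, weaker bound).
[cite: LimayeSrinivasanTavenas2025, Claim 16] -/
theorem Phi_mono (k : ℕ) {p p' : ℕ} (h : p ≤ p') {x : ℝ} (hx : 1 ≤ x) : Phi k p x ≤ Phi k p' x := by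
  unfold Phi
  refine Real.rpow_le_rpow_of_exponent_le (by norm_num) ?_
  have : x ^ mu p' ≤ x ^ mu p := Real.rpow_le_rpow_of_exponent_le hx (mu_antitone h)
  have hk : (0 : ℝ) ≤ k := Nat.cast_nonneg k
  nlinarith [mul_le_mul_of_nonneg_left this hk]

/-- `Φ_p(x) = 2^{-k y/20}` whenever `x^{μ_p} = y` (reparametrisation). [folklore] -/
theorem Phi_eq_of_rpow_eq (k p : ℕ) {x y : ℝ} (h : x ^ mu p = y) :
    Phi k p x = (2 : ℝ) ^ (-(k : ℝ) * y / 20) := by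
  unfold Phi; rw [h]

/-- **The threshold exponents.** For `0 < μ ≤ 1` put `μ' = μ/(4+3μ)`, `a = (1-μ')/2`,
`b = (1-3μ')/4`. Then `0 < μ' ≤ 1/7`, `b μ = μ'`, `a - 2b = μ'`, `1 - 2a = μ'`, `0 ≤ b ≤ a`,
`2a ≤ 1`. [cite: LimayeSrinivasanTavenas2025, Claim 16] -/
theorem threshold_exponents {μ : ℝ} (h0 : 0 < μ) (h1 : μ ≤ 1) :
    0 < μ / (4 + 3 * μ) ∧ μ / (4 + 3 * μ) ≤ 1 / 7 ∧
      (1 - 3 * (μ / (4 + 3 * μ))) / 4 * μ = μ / (4 + 3 * μ) ∧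
      (1 - μ / (4 + 3 * μ)) / 2 - 2 * ((1 - 3 * (μ / (4 + 3 * μ))) / 4) = μ / (4 + 3 * μ) ∧
      1 - 2 * ((1 - μ / (4 + 3 * μ)) / 2) = μ / (4 + 3 * μ) ∧
      0 ≤ (1 - 3 * (μ / (4 + 3 * μ))) / 4 ∧
      (1 - 3 * (μ / (4 + 3 * μ))) / 4 ≤ (1 - μ / (4 + 3 * μ)) / 2 ∧
      2 * ((1 - μ / (4 + 3 * μ)) / 2) ≤ 1 := by
  have hden : 0 < 4 + 3 * μ := by linarith
  have hμ' : μ / (4 + 3 * μ) ≤ 1 / 7 := by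
    rw [div_le_div_iff₀ hden (by norm_num)]; linarith
  have hμ'0 : 0 < μ / (4 + 3 * μ) := div_pos h0 hden
  refine ⟨hμ'0, hμ', ?_, ?_, ?_, ?_, ?_, ?_⟩
  · field_simp; ring
  · ring
  · ring
  · linarith
  · linarith
  · linarith

end Exponents


/-! ### Thresholds -/

section Thresholds

/-- **The thresholds `θ_A = m^a ≥ θ_B = m^b`** for a level `p` and a block count `1 ≤ m ≤ d`
with `10 d ≤ k`: both are `≥ 1`, `10 θ² ≤ k`, and the three exponents of the analysis all
equal `k m^{μ_{p+1}}/20`: `Φ_p(θ_B) = Φ_{p+1}(m)`, `2^{-k θ_A/(20 θ_B²)} = Φ_{p+1}(m)`,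
`2^{-k m/(20 θ_A²)} = Φ_{p+1}(m)` (LST 2025, proof of Claim 16, choice of `T_Δ`).
[cite: LimayeSrinivasanTavenas2025, Claim 16] -/
theorem thresholds (k p : ℕ) {m d : ℕ} (hm1 : 1 ≤ m) (hmd : m ≤ d) (hk : 10 * d ≤ k) :
    ∃ θA θB : ℝ, 1 ≤ θB ∧ θB ≤ θA ∧ 10 * θA ^ 2 ≤ k ∧ 10 * θB ^ 2 ≤ k ∧
      Phi k p θB = Phi k (p + 1) m ∧
      (2 : ℝ) ^ (-(k : ℝ) * θA / (20 * θB ^ 2)) = Phi k (p + 1) m ∧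
      (2 : ℝ) ^ (-(k : ℝ) * m / (20 * θA ^ 2)) = Phi k (p + 1) m := by
  obtain ⟨hμ'0, -, hbμ, ha2b, h12a, hb0, hba, h2a⟩ := threshold_exponents (mu_pos p) (mu_le_one p)
  set μ := mu p with hμ
  set μ' := μ / (4 + 3 * μ) with hμ'def
  have hμ'eq : mu (p + 1) = μ' := by simp only [mu, hμ'def, hμ]
  set a := (1 - μ') / 2 with ha
  set b := (1 - 3 * μ') / 4 with hb
  have hmR : (1 : ℝ) ≤ m := by exact_mod_cast hm1
  have hm0 : (0 : ℝ) ≤ m := by linarith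
  have hmpos : (0 : ℝ) < m := by linarith
  refine ⟨(m : ℝ) ^ a, (m : ℝ) ^ b, Real.one_le_rpow hmR hb0,
    Real.rpow_le_rpow_of_exponent_le hmR hba, ?_, ?_, ?_, ?_, ?_⟩
  · -- `θ_A² = m^{2a} ≤ m ≤ d ≤ k/10`
    have h1 : ((m : ℝ) ^ a) ^ 2 ≤ m := by
      rw [← Real.rpow_natCast, ← Real.rpow_mul hm0]
      calc (m : ℝ) ^ (a * (2 : ℕ)) ≤ (m : ℝ) ^ (1 : ℝ) :=
            Real.rpow_le_rpow_of_exponent_le hmR (by push_cast; linarith)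
        _ = m := Real.rpow_one _
    have h2 : (m : ℝ) ≤ d := by exact_mod_cast hmd
    have h3 : (10 : ℝ) * d ≤ k := by exact_mod_cast hk
    linarith
  · have h1 : ((m : ℝ) ^ b) ^ 2 ≤ m := by
      rw [← Real.rpow_natCast, ← Real.rpow_mul hm0]
      calc (m : ℝ) ^ (b * (2 : ℕ)) ≤ (m : ℝ) ^ (1 : ℝ) :=
            Real.rpow_le_rpow_of_exponent_le hmR (by push_cast; linarith)
        _ = m := Real.rpow_one _
    have h2 : (m : ℝ) ≤ d := by exact_mod_cast hmd
    have h3 : (10 : ℝ) * d ≤ k := by exact_mod_cast hk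
    linarith
  · unfold Phi
    rw [hμ'eq, ← Real.rpow_mul hm0, hbμ]
  · unfold Phi
    rw [hμ'eq]
    congr 1
    have hq : (m : ℝ) ^ a / ((m : ℝ) ^ b) ^ 2 = (m : ℝ) ^ μ' := by
      rw [← Real.rpow_natCast, ← Real.rpow_mul hm0, ← Real.rpow_sub hmpos]
      congr 1; push_cast; linarith
    rw [show -(k : ℝ) * (m : ℝ) ^ a / (20 * ((m : ℝ) ^ b) ^ 2) =
      -(k : ℝ) / 20 * ((m : ℝ) ^ a / ((m : ℝ) ^ b) ^ 2) by ring, hq]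
    ring
  · unfold Phi
    rw [hμ'eq]
    congr 1
    have hq : (m : ℝ) / ((m : ℝ) ^ a) ^ 2 = (m : ℝ) ^ μ' := by
      rw [← Real.rpow_natCast, ← Real.rpow_mul hm0]
      rw [show (m : ℝ) / (m : ℝ) ^ (a * (2 : ℕ)) = (m : ℝ) ^ (1 : ℝ) / (m : ℝ) ^ (a * (2 : ℕ)) by
        rw [Real.rpow_one], ← Real.rpow_sub hmpos]
      congr 1; push_cast; linarith
    rw [show -(k : ℝ) * (m : ℝ) / (20 * ((m : ℝ) ^ a) ^ 2) =
      -(k : ℝ) / 20 * ((m : ℝ) / ((m : ℝ) ^ a) ^ 2) by ring, hq]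
    ring

end Thresholds

/-! ### The induction -/

section Induction

variable {K : Type u} [Field K] {d : ℕ} (k : ℕ) (pos : Fin d → Bool)
variable {σ₀ : Type} [Fintype σ₀] {blk₀ : σ₀ → Fin d}
variable (g : σ₀ → MvPolynomial (Σ i : Fin d, BlockVar k pos i) K) (P : ArithCircuit K σ₀)

/-- The values the induction speaks about at level `p`: values of gates of product-depth `≤ p`
(pushed along the substitution `g`), the images `g v` of the variables, and constants
(LST 2025, §5: the sub-formulas of product-depth `≤ Δ`).
[cite: LimayeSrinivasanTavenas2025, Claim 16] -/
def InL (p : ℕ) (x : MvPolynomial (Σ i : Fin d, BlockVar k pos i) K) : Prop :=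
  (∃ j, P.gatePD j ≤ p ∧ x = aeval g (P.gateVal j)) ∨ (∃ v, x = g v) ∨ (∃ c : K, x = C c)

/-- The induction hypothesis at level `p` with constant `Λ`: `relrk_{w|T}(x) ≤ Λ Φ_p(#T)` for
all `x` of level `p` and all nonempty `T` (LST 2025, Claim 16 for product-depth `p`).
[cite: LimayeSrinivasanTavenas2025, Claim 16] -/
def IHolds (p : ℕ) (Λ : ℝ) : Prop :=
  ∀ x, InL k pos g P p x → ∀ T : Finset (Fin d), T.Nonempty →
    relRank K pos T x ≤ Λ * Phi k p T.card

variable {k pos g P}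

omit [Fintype σ₀] in
/-- Levels are monotone. [cite: LimayeSrinivasanTavenas2025, Claim 16] -/
theorem InL.mono {p p' : ℕ} (h : p ≤ p') {x : MvPolynomial (Σ i : Fin d, BlockVar k pos i) K}
    (hx : InL k pos g P p x) : InL k pos g P p' x := by
  rcases hx with ⟨j, hj, rfl⟩ | hx
  · exact Or.inl ⟨j, hj.trans h, rfl⟩
  · exact Or.inr hx

omit [Fintype σ₀] in
/-- The value of an operand of gate `j` is of level `opPD` (a gate of that product-depth, a
variable image, or a constant). [cite: LimayeSrinivasanTavenas2025, Claim 16] -/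
theorem inL_opVal (j : ℕ) (u : ArithCircuit.Operand K σ₀) :
    InL k pos g P (P.opPD j u) (aeval g (P.opVal j u)) := by
  cases u with
  | var v => exact Or.inr (Or.inl ⟨v, by simp⟩)
  | const c => exact Or.inr (Or.inr ⟨c, by simp [MvPolynomial.algebraMap_eq]⟩)
  | gate j' =>
    simp only [ArithCircuit.opVal_gate, ArithCircuit.opPD_gate]
    split_ifs with h
    · exact Or.inl ⟨j', le_rfl, rfl⟩
    · exact Or.inr (Or.inr ⟨0, by simp⟩)

variable (hg : IsBlockPreserving blk₀ Sigma.fst g)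
include hg

omit [Fintype σ₀] in
/-- **Leaves**: `relrk_{w|T}(g v) ≤ Φ_p(#T)` when `k ≥ 10` (zero unless `T = {blk v}`; there
`Φ_p(1) = 2^{-k/20}`). [cite: LimayeSrinivasanTavenas2025, Claim 16] -/
theorem relRank_var_le (hk : 10 ≤ k) (p : ℕ) (v : σ₀) (T : Finset (Fin d)) :
    relRank K pos T (g v) ≤ Phi k p T.card := by
  by_cases h : T = {blk₀ v}
  · have hcard : T.card = 1 := by rw [h, Finset.card_singleton]
    refine (relRank_blockLinear_le k pos (hg v) hk).trans (le_of_eq ?_)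
    rw [hcard, Phi]
    simp
  · rw [relRank_eq_zero_of_blockLinear k pos (hg v) h]
    exact (Phi_pos k p _).le

omit hg in
/-- Constants: `relrk_{w|T}(C c) = 0 ≤ Φ`. [folklore] -/
theorem relRank_const_le (p : ℕ) (c : K) {T : Finset (Fin d)} (hT : T.Nonempty) :
    relRank K pos T (C c : MvPolynomial (Σ i : Fin d, BlockVar k pos i) K) ≤ Phi k p T.card := by
  rw [relRank_C_eq_zero k pos c hT]
  exact (Phi_pos k p _).le

omit [Field K] [Fintype σ₀] hg in
/-- A product gate has product-depth at least `1`. [cite: LimayeSrinivasanTavenas2025, §1] -/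
theorem one_le_gatePD_of_prod {j : ℕ} {args : List (ArithCircuit.Operand K σ₀)}
    (hj : P.gates[j]? = some (.prod args)) : 1 ≤ P.gatePD j := by
  unfold ArithCircuit.gatePD
  rw [List.getD_eq_getElem?_getD, ArithCircuit.gateWDepths_getElem? _ _ _ _ hj, Option.getD_some]
  simp [ArithCircuit.prodWeight, ArithCircuit.Gate.isProd]

/-- **Sum closure with a bound on product gates**: if every product gate of product-depth `≤ p`
has `relrk ≤ B Φ_p` then every gate of product-depth `≤ p` has `relrk ≤ (s B + N) Φ_p`
(`s` gates, `N` variables; LST 2025, proof of Claim 16: "the result directly follows from the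
subadditivity"). [cite: LimayeSrinivasanTavenas2025, Claim 16] -/
theorem relRank_gate_le_of_prod_le (hk : 10 ≤ k) (p : ℕ) {B : ℝ} (hB : 0 ≤ B)
    (hprod : ∀ j args, P.gates[j]? = some (.prod args) → P.gatePD j ≤ p →
      ∀ T : Finset (Fin d), T.Nonempty → relRank K pos T (aeval g (P.gateVal j)) ≤ B * Phi k p T.card)
    (j : ℕ) (hj : P.gatePD j ≤ p) {T : Finset (Fin d)} (hT : T.Nonempty) :
    relRank K pos T (aeval g (P.gateVal j)) ≤ (P.size * B + Fintype.card σ₀) * Phi k p T.card := by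
  classical
  have hmem : aeval g (P.gateVal j) ∈ Submodule.span K
      (Set.range fun y => aeval g (P.spanFamily p y)) := by
    have h1 := P.span_spanFamily_mono hj (P.gateVal_mem_span_spanFamily j)
    have h2 : aeval g (P.gateVal j) ∈
        Submodule.span K ((aeval g).toLinearMap '' Set.range (P.spanFamily p)) := by
      rw [← Submodule.map_span]
      exact Submodule.mem_map_of_mem h1
    rwa [← Set.range_comp] at h2
  refine (relRank_le_sum_of_mem_span pos T hmem).trans ?_
  rw [Fintype.sum_sum_type, Fintype.sum_sum_type]
  have h1 : ∑ j' : Fin P.size, relRank K pos T (aeval g (P.spanFamily p (.inl j'))) ≤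
      P.size * B * Phi k p T.card := by
    calc ∑ j' : Fin P.size, relRank K pos T (aeval g (P.spanFamily p (.inl j')))
        ≤ ∑ _j' : Fin P.size, B * Phi k p T.card := Finset.sum_le_sum fun j' _ => by
          rcases P.spanFamily_inl_eq p j' with h0 | ⟨⟨args, hargs⟩, hpd, heq⟩
          · rw [h0, map_zero, relRank_zero]
            exact mul_nonneg hB (Phi_pos k p _).le
          · rw [heq]
            exact hprod j' args hargs hpd T hT
      _ = P.size * B * Phi k p T.card := by
          rw [Finset.sum_const, Finset.card_univ, Fintype.card_fin, nsmul_eq_mul, mul_assoc]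
  have h2 : ∑ v : σ₀, relRank K pos T (aeval g (P.spanFamily p (.inr (.inl v)))) ≤
      Fintype.card σ₀ * Phi k p T.card := by
    calc ∑ v : σ₀, relRank K pos T (aeval g (P.spanFamily p (.inr (.inl v))))
        ≤ ∑ _v : σ₀, Phi k p T.card := Finset.sum_le_sum fun v _ => by
          simp only [ArithCircuit.spanFamily, aeval_X]
          exact relRank_var_le hg hk p v T
      _ = Fintype.card σ₀ * Phi k p T.card := by
          rw [Finset.sum_const, Finset.card_univ, nsmul_eq_mul]
  have h3 : ∑ u : Unit, relRank K pos T (aeval g (P.spanFamily p (.inr (.inr u)))) = 0 := by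
    rw [Fintype.sum_unique]
    simp only [ArithCircuit.spanFamily, map_one]
    rw [← C_1]
    exact relRank_C_eq_zero k pos 1 hT
  rw [h3, add_zero, add_mul]
  exact add_le_add h1 h2

/-- **Base of the induction** (`p = 0`): gates of product-depth `0` are affine in the
block-linear forms `g v` (no product gate has product-depth `0`), so `IH 0` holds with
`Λ_0 = N + 1`. [cite: LimayeSrinivasanTavenas2025, Claim 16] -/
theorem iholds_zero (hk : 10 ≤ k) : IHolds k pos g P 0 (Fintype.card σ₀ + 1) := by
  intro x hx T hT
  rcases hx with ⟨j, hj, rfl⟩ | ⟨v, rfl⟩ | ⟨c, rfl⟩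
  · have h := relRank_gate_le_of_prod_le hg hk 0 le_rfl (B := 0) ?_ j hj hT
    · refine h.trans ?_
      have := Phi_pos k 0 (T.card : ℝ)
      nlinarith
    · intro j' args hargs hpd
      exact absurd (one_le_gatePD_of_prod hargs) (by omega)
  · refine (relRank_var_le hg hk 0 v T).trans ?_
    have := Phi_pos k 0 (T.card : ℝ)
    have : (0 : ℝ) ≤ Fintype.card σ₀ := Nat.cast_nonneg _
    nlinarith
  · refine (relRank_const_le 0 c hT).trans ?_
    have := Phi_pos k 0 (T.card : ℝ)
    have : (0 : ℝ) ≤ Fintype.card σ₀ := Nat.cast_nonneg _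
    nlinarith

omit hg in
/-- **Products over a labelled partition with a threshold** (the type-1/type-2 dichotomy of
LST 2025, proof of Claim 16): if the factors are set-multilinear over pairwise disjoint parts,
every factor on a part of size `≥ θ` has `relrk ≤ C`, and `10 θ² ≤ k`, then the product has
`relrk ≤ max C 2^{-k (∑ #parts)/(20 θ²)}`. [cite: LimayeSrinivasanTavenas2025, Claim 16] -/
theorem relRank_prod_partition_le {ι' : Type*} [Fintype ι'] [DecidableEq ι']
    (Part : ι' → Finset (Fin d)) (Fac : ι' → MvPolynomial (Σ i : Fin d, BlockVar k pos i) K)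
    (hdisj : ((Finset.univ : Finset ι') : Set ι').PairwiseDisjoint Part)
    (hsml : ∀ x, IsSetMultilinear Sigma.fst (Part x) (Fac x))
    {θ C : ℝ} (hθk : 10 * θ ^ 2 ≤ k)
    (hbig : ∀ x, θ ≤ ((Part x).card : ℝ) → relRank K pos (Part x) (Fac x) ≤ C) :
    relRank K pos (Finset.univ.biUnion Part) (∏ x, Fac x) ≤
      max C ((2 : ℝ) ^ (-(k : ℝ) * (∑ x, ((Part x).card : ℝ)) / (20 * θ ^ 2))) := by
  rw [relRank_finset_prod pos Finset.univ Part Fac hdisj (fun x _ => hsml x)]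
  have h0 : ∀ x, 0 ≤ relRank K pos (Part x) (Fac x) := fun x => relRank_nonneg pos _ _
  have h1 : ∀ x, relRank K pos (Part x) (Fac x) ≤ 1 := fun x => relRank_le_one pos _ _
  by_cases hbigx : ∃ x, θ ≤ ((Part x).card : ℝ)
  · obtain ⟨x, hx⟩ := hbigx
    refine le_trans ?_ (le_max_left _ _)
    calc ∏ y, relRank K pos (Part y) (Fac y)
        = relRank K pos (Part x) (Fac x) * ∏ y ∈ Finset.univ.erase x, relRank K pos (Part y) (Fac y) :=
          (Finset.mul_prod_erase _ _ (Finset.mem_univ x)).symm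
      _ ≤ relRank K pos (Part x) (Fac x) * 1 :=
          mul_le_mul_of_nonneg_left (Finset.prod_le_one (fun y _ => h0 y) fun y _ => h1 y) (h0 x)
      _ ≤ C := by rw [mul_one]; exact hbig x hx
  · push Not at hbigx
    refine le_trans ?_ (le_max_right _ _)
    calc ∏ y, relRank K pos (Part y) (Fac y)
        ≤ ∏ y, (2 : ℝ) ^ (-(|(wsum k pos (Part y) : ℝ)|) / 2) :=
          Finset.prod_le_prod (fun y _ => h0 y) fun y _ => relRank_le_two_pow_wsum k pos _ _
      _ ≤ _ := prod_two_pow_wsum_le k pos Finset.univ Part hθk fun y _ => hbigx y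

omit hg in
/-- The normalised factor `ỹ = c⁻¹ (x - c)` of a value `x` with constant term `c`
(LST 2025, Lemma 20; `= newtonY` on the members of `unitOps`).
[cite: LimayeSrinivasanTavenas2025, Lemma 20] -/
def ytil (x : MvPolynomial (Σ i : Fin d, BlockVar k pos i) K) :
    MvPolynomial (Σ i : Fin d, BlockVar k pos i) K :=
  C (coeff 0 x)⁻¹ * (x - C (coeff 0 x))

omit hg in
/-- `newtonY L l = ỹ ((unitOps L)[l])` (unfolding). [cite: LimayeSrinivasanTavenas2025, Lemma 20] -/
theorem newtonY_eq_ytil (L : List (MvPolynomial (Σ i : Fin d, BlockVar k pos i) K))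
    (l : Fin (unitOps L).length) : newtonY L l = ytil (k := k) (pos := pos) (unitOps L)[(l : ℕ)] := rfl

omit hg in
open Classical in
/-- The power sums, de-duplicated: `p_i(y) = ∑_{x ∈ unitOps L, distinct} (multiplicity) • ỹ(x)^i`.
[cite: LimayeSrinivasanTavenas2025, Lemma 20] -/
theorem newtonPow_eq_sum_toFinset (L : List (MvPolynomial (Σ i : Fin d, BlockVar k pos i) K))
    (i : ℕ) : newtonPow L i = ∑ x ∈ (unitOps L).toFinset,
      (((unitOps L).count x : ℕ) : K) • ytil (k := k) (pos := pos) x ^ i := by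
  classical
  unfold newtonPow
  have h1 : ∑ l : Fin (unitOps L).length, newtonY L l ^ i =
      ((unitOps L).map fun x => ytil (k := k) (pos := pos) x ^ i).sum := by
    rw [← List.sum_ofFn, ← List.ofFn_getElem_eq_map]
    rfl
  rw [h1, Finset.sum_list_map_count]
  refine Finset.sum_congr rfl fun x _ => ?_
  rw [Nat.cast_smul_eq_nsmul]

omit hg in
/-- `ỹ` of a constant is `0`. [folklore] -/
theorem ytil_C (c : K) : ytil (k := k) (pos := pos) (C c) = 0 := by
  simp [ytil]

omit hg in
/-- `ỹ(x)` has no constant term. [cite: LimayeSrinivasanTavenas2025, Lemma 20] -/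
theorem coeff_zero_ytil (x : MvPolynomial (Σ i : Fin d, BlockVar k pos i) K) :
    coeff 0 (ytil (k := k) (pos := pos) x) = 0 := by
  simp [ytil]

omit hg in
/-- Projections of `ỹ(x)`: `smlProj W ỹ(x) = c⁻¹ · smlProj W x` for `W ≠ ∅`, `0` for `W = ∅`.
[cite: LimayeSrinivasanTavenas2025, Lemma 20] -/
theorem smlProj_ytil (x : MvPolynomial (Σ i : Fin d, BlockVar k pos i) K) (W : Finset (Fin d)) :
    smlProj Sigma.fst W (ytil (k := k) (pos := pos) x) =
      if W = ∅ then 0 else C (coeff 0 x)⁻¹ * smlProj Sigma.fst W x := by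
  split_ifs with hW
  · rw [hW, smlProj_empty_eq_zero _ (coeff_zero_ytil x)]
  · rw [ytil, smlProj_C_mul, map_sub, smlProj_C, if_neg hW, sub_zero]

omit [Fintype σ₀] hg in
open Classical in
/-- **Level B** (LST 2025, proof of Claim 16 applied to the `ΣΠ` expression of a power sum in
its operands): for a list `L` of values of level `p` of which the non-constant ones lie in a set
of size `≤ s + N`, a block set `V` of size `≥ θ_A`, and `i ≤ m`:
`relrk_{w|V}(p_i(y)) ≤ (s + N) (m+1)^m · max (Λ Φ_p(θ_B)) (2^{-k θ_A/(20 θ_B²)})`.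
[cite: LimayeSrinivasanTavenas2025, Claim 16] -/
theorem relRank_newtonPow_le {p : ℕ} {Λ : ℝ} (hΛ : 0 ≤ Λ) (hIH : IHolds k pos g P p Λ)
    (L : List (MvPolynomial (Σ i : Fin d, BlockVar k pos i) K))
    (Img : Finset (MvPolynomial (Σ i : Fin d, BlockVar k pos i) K)) {s' : ℕ} (hImg : Img.card ≤ s')
    (hL : ∀ x ∈ L, InL k pos g P p x) (hLImg : ∀ x ∈ L, x ∈ Img ∨ ∃ c : K, x = C c)
    {θA θB : ℝ} (hθB1 : 1 ≤ θB) (hθBA : θB ≤ θA) (hθBk : 10 * θB ^ 2 ≤ k)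
    {m : ℕ} (V : Finset (Fin d)) (hVθ : θA ≤ (V.card : ℝ)) (hVm : V.card ≤ m) {i : ℕ} (hi : i ≤ m) :
    relRank K pos V (newtonPow L i) ≤ (s' * (m + 1) ^ m : ℕ) *
      max (Λ * Phi k p θB) ((2 : ℝ) ^ (-(k : ℝ) * θA / (20 * θB ^ 2))) := by
  classical
  have hV : V.Nonempty := by
    rw [← Finset.card_pos]
    have : (0 : ℝ) < V.card := by linarith
    exact_mod_cast this
  set By : ℝ := max (Λ * Phi k p θB) ((2 : ℝ) ^ (-(k : ℝ) * θA / (20 * θB ^ 2))) with hBy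
  have hBy0 : 0 ≤ By := le_trans (by positivity) (le_max_right _ _)
  -- Step 1: the bound for one non-constant value `x` of level `p`
  have hx_bound : ∀ x, InL k pos g P p x →
      relRank K pos V (ytil (k := k) (pos := pos) x ^ i) ≤ ((m + 1) ^ m : ℕ) * By := by
    intro x hx
    rw [← relRank_smlProj pos V]
    refine (relRank_le_sum_of_mem_span pos V (smlProj_pow_mem_span Sigma.fst V _ i)).trans ?_
    have hterm : ∀ b' : V → Fin i,
        relRank K pos V (∏ q : Fin i, smlProj Sigma.fst (blockPart V b' q)
          (ytil (k := k) (pos := pos) x)) ≤ By := by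
      intro b'
      by_cases hempty : ∃ q, blockPart V b' q = ∅
      · obtain ⟨q, hq⟩ := hempty
        have h0 : smlProj Sigma.fst (blockPart V b' q) (ytil (k := k) (pos := pos) x) = 0 := by
          rw [smlProj_ytil, if_pos hq]
        rw [Finset.prod_eq_zero (Finset.mem_univ q) h0, relRank_zero]
        exact hBy0
      · push Not at hempty
        -- all parts nonempty: pull out the scalars
        have hprod : (∏ q : Fin i, smlProj Sigma.fst (blockPart V b' q) (ytil (k := k) (pos := pos) x)) =
            ((coeff 0 x)⁻¹ ^ i) • ∏ q : Fin i, smlProj Sigma.fst (blockPart V b' q) x := by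
          rw [← C_mul', map_pow, ← Fin.prod_const i (C (coeff 0 x)⁻¹), ← Finset.prod_mul_distrib]
          exact Finset.prod_congr rfl fun q _ => by
            rw [smlProj_ytil, if_neg (Finset.nonempty_iff_ne_empty.1 (hempty q))]
        rw [hprod]
        refine (relRank_smul_le pos V _ _).trans ?_
        have key := relRank_prod_partition_le (K := K) (blockPart V b')
          (fun q => smlProj Sigma.fst (blockPart V b' q) x)
          (fun q _ q' _ h => disjoint_blockPart b' h) (fun q => isSetMultilinear_smlProj _ _ _)
          hθBk (C := Λ * Phi k p θB) ?_
        · rw [biUnion_blockPart] at key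
          refine key.trans (max_le_max le_rfl ?_)
          refine Real.rpow_le_rpow_of_exponent_le (by norm_num) ?_
          have hsum : (∑ q : Fin i, ((blockPart V b' q).card : ℝ)) = V.card := by
            have := sum_card_blockPart b'; exact_mod_cast this
          rw [hsum, div_le_div_iff_of_pos_right (by positivity), neg_mul, neg_mul, neg_le_neg_iff]
          exact mul_le_mul_of_nonneg_left hVθ (Nat.cast_nonneg k)
        · intro q hq
          have hne : (blockPart V b' q).Nonempty := by
            rw [← Finset.card_pos]
            have : (0 : ℝ) < (blockPart V b' q).card := by linarith
            exact_mod_cast this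
          rw [relRank_smlProj]
          refine (hIH x hx _ hne).trans ?_
          exact mul_le_mul_of_nonneg_left (Phi_antitone k p (by linarith) hq) hΛ
    calc ∑ b' : V → Fin i, relRank K pos V (∏ q : Fin i,
          smlProj Sigma.fst (blockPart V b' q) (ytil (k := k) (pos := pos) x))
        ≤ ∑ _b' : V → Fin i, By := Finset.sum_le_sum fun b' _ => hterm b'
      _ = (Fintype.card (V → Fin i)) * By := by
          rw [Finset.sum_const, Finset.card_univ, nsmul_eq_mul]
      _ ≤ ((m + 1) ^ m : ℕ) * By := by
          refine mul_le_mul_of_nonneg_right ?_ hBy0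
          norm_cast
          rw [Fintype.card_fun, Fintype.card_fin, Fintype.card_coe]
          calc i ^ V.card ≤ (m + 1) ^ V.card := Nat.pow_le_pow_left (by omega) _
            _ ≤ (m + 1) ^ m := Nat.pow_le_pow_right (Nat.succ_pos m) hVm
  -- Step 2: de-duplicate and sum
  rw [newtonPow_eq_sum_toFinset (k := k) (pos := pos)]
  refine (relRank_sum_smul_le pos _ V _ _).trans ?_
  rw [← Finset.sum_filter_add_sum_filter_not _ (fun x => x ∈ Img)]
  have hconst : ∑ x ∈ (unitOps L).toFinset.filter (fun x => x ∉ Img),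
      relRank K pos V (ytil (k := k) (pos := pos) x ^ i) = 0 := by
    refine Finset.sum_eq_zero fun x hx => ?_
    rw [Finset.mem_filter, List.mem_toFinset] at hx
    rcases hLImg x (mem_of_mem_unitOps hx.1) with h | ⟨c, rfl⟩
    · exact absurd h hx.2
    · rw [ytil_C]
      rcases Nat.eq_zero_or_pos i with rfl | hi0
      · rw [pow_zero, ← C_1]; exact relRank_C_eq_zero k pos 1 hV
      · rw [zero_pow hi0.ne', relRank_zero]
  rw [hconst, add_zero]
  calc ∑ x ∈ (unitOps L).toFinset.filter (fun x => x ∈ Img),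
        relRank K pos V (ytil (k := k) (pos := pos) x ^ i)
      ≤ ∑ _x ∈ (unitOps L).toFinset.filter (fun x => x ∈ Img), ((m + 1) ^ m : ℕ) * By :=
        Finset.sum_le_sum fun x hx => by
          rw [Finset.mem_filter, List.mem_toFinset] at hx
          exact hx_bound x (hL x (mem_of_mem_unitOps hx.1))
    _ = ((unitOps L).toFinset.filter (fun x => x ∈ Img)).card * (((m + 1) ^ m : ℕ) * By) := by
        rw [Finset.sum_const, nsmul_eq_mul]
    _ ≤ s' * (((m + 1) ^ m : ℕ) * By) := by
        refine mul_le_mul_of_nonneg_right ?_ (by positivity)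
        have h1 : ((unitOps L).toFinset.filter (fun x => x ∈ Img)).card ≤ Img.card :=
          Finset.card_le_card fun x hx => (Finset.mem_filter.1 hx).2
        exact_mod_cast h1.trans hImg
    _ = (s' * (m + 1) ^ m : ℕ) * By := by push_cast; ring


omit [Fintype σ₀] hg in
open Classical in
/-- **Level A: one structured generator** (LST 2025, proof of Claim 16, the case analysis on the
factors of a product): for a list `L` of values of level `p` and a nonempty `T`, every generator
`newtonGen L T gi` has `relrk_{w|T} ≤ (s'+1)(m+1)^m Λ Φ_{p+1}(m)` (`m = #T`).
[cite: LimayeSrinivasanTavenas2025, Claim 16] -/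
theorem relRank_newtonGen_le {p : ℕ} {Λ : ℝ} (hΛ : 1 ≤ Λ) (hIH : IHolds k pos g P p Λ)
    (hk : 10 * d ≤ k) (L : List (MvPolynomial (Σ i : Fin d, BlockVar k pos i) K))
    (Img : Finset (MvPolynomial (Σ i : Fin d, BlockVar k pos i) K)) {s' : ℕ} (hImg : Img.card ≤ s')
    (hL : ∀ x ∈ L, InL k pos g P p x) (hLImg : ∀ x ∈ L, x ∈ Img ∨ ∃ c : K, x = C c)
    (T : Finset (Fin d)) (hT : T.Nonempty) (gi : NewtonIdx L T) :
    relRank K pos T (newtonGen Sigma.fst L T gi) ≤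
      ((s' + 1) * (T.card + 1) ^ T.card : ℕ) * (Λ * Phi k (p + 1) T.card) := by
  set m := T.card with hm
  have hm1 : 1 ≤ m := Finset.card_pos.2 hT
  have hmd : m ≤ d := by simpa using Finset.card_le_univ T
  have hΛ0 : 0 ≤ Λ := by linarith
  obtain ⟨θA, θB, hθB1, hθBA, hθAk, hθBk, hE1, hE2, hE3⟩ := thresholds k p hm1 hmd hk
  obtain ⟨⟨S₀, hS₀⟩, a₀, κ, b₀⟩ := gi
  have hS₀T : S₀ ⊆ T := Finset.mem_powerset.1 hS₀
  set ΛΦ := Λ * Phi k (p + 1) m with hΛΦ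
  have hΛΦ0 : 0 ≤ ΛΦ := mul_nonneg hΛ0 (Phi_pos k _ _).le
  have hΦle : Phi k (p + 1) m ≤ ΛΦ := le_mul_of_one_le_left (Phi_pos k _ _).le hΛ
  -- the factor family of the generator
  let Part : Fin (zeroOps L).length ⊕ Fin κ.1 → Finset (Fin d) :=
    Sum.elim (blockPart S₀ a₀) (blockPart (T \ S₀) b₀)
  let Fac : Fin (zeroOps L).length ⊕ Fin κ.1 → MvPolynomial (Σ i : Fin d, BlockVar k pos i) K :=
    Sum.elim (fun q => smlProj Sigma.fst (blockPart S₀ a₀ q) (zeroOps L)[(q : ℕ)])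
      (fun q => smlProj Sigma.fst (blockPart (T \ S₀) b₀ q) (newtonPow L (κ.2 q)))
  have hgen : newtonGen Sigma.fst L T ⟨⟨S₀, hS₀⟩, a₀, κ, b₀⟩ = ∏ x, Fac x := by
    rw [newtonGen_eq, Fintype.prod_sum_type]
    rfl
  have hdisj : ((Finset.univ : Finset (Fin (zeroOps L).length ⊕ Fin κ.1)) :
      Set (Fin (zeroOps L).length ⊕ Fin κ.1)).PairwiseDisjoint Part := by
    intro x _ y _ hxy
    rcases x with q | q <;> rcases y with q' | q'
    · exact disjoint_blockPart a₀ fun h => hxy (by rw [h])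
    · exact Finset.disjoint_of_subset_left (blockPart_subset a₀ q)
        (Finset.disjoint_of_subset_right (blockPart_subset b₀ q') Finset.disjoint_sdiff)
    · exact Finset.disjoint_of_subset_left (blockPart_subset b₀ q)
        (Finset.disjoint_of_subset_right (blockPart_subset a₀ q') Finset.sdiff_disjoint)
    · exact disjoint_blockPart b₀ fun h => hxy (by rw [h])
  have hcover : Finset.univ.biUnion Part = T := by
    ext i
    simp only [Finset.mem_biUnion, Finset.mem_univ, true_and]
    constructor
    · rintro ⟨x, hx⟩
      rcases x with q | q
      · exact hS₀T (blockPart_subset a₀ q hx)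
      · exact Finset.sdiff_subset (blockPart_subset b₀ q hx)
    · intro hi
      by_cases hiS : i ∈ S₀
      · exact ⟨.inl (a₀ ⟨i, hiS⟩), (mem_blockPart a₀ _ i).2 ⟨hiS, rfl⟩⟩
      · refine ⟨.inr (b₀ ⟨i, Finset.mem_sdiff.2 ⟨hi, hiS⟩⟩), (mem_blockPart b₀ _ i).2 ⟨_, rfl⟩⟩
  have hsml : ∀ x, IsSetMultilinear Sigma.fst (Part x) (Fac x) := by
    rintro (q | q) <;> exact isSetMultilinear_smlProj _ _ _
  have hsum : (∑ x, ((Part x).card : ℝ)) = m := by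
    rw [Fintype.sum_sum_type]
    simp only [Part, Sum.elim_inl, Sum.elim_inr]
    have h1 : (∑ q : Fin (zeroOps L).length, ((blockPart S₀ a₀ q).card : ℝ)) = S₀.card := by
      exact_mod_cast sum_card_blockPart a₀
    have h2 : (∑ q : Fin κ.1, ((blockPart (T \ S₀) b₀ q).card : ℝ)) = (T \ S₀).card := by
      exact_mod_cast sum_card_blockPart b₀
    rw [h1, h2]
    have h3 := Finset.card_sdiff_add_card_eq_card hS₀T
    exact_mod_cast (by omega : S₀.card + (T \ S₀).card = m)
  -- the bound for a large part
  set Cbig : ℝ := ((s' * (m + 1) ^ m : ℕ) + 1) * ΛΦ with hCbig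
  have hbig : ∀ x, θA ≤ ((Part x).card : ℝ) → relRank K pos (Part x) (Fac x) ≤ Cbig := by
    intro x hx
    have hne : (Part x).Nonempty := by
      rw [← Finset.card_pos]
      have : (0 : ℝ) < (Part x).card := by linarith
      exact_mod_cast this
    rcases x with q | q
    · -- an operand part: use `IH p`
      change relRank K pos (blockPart S₀ a₀ q)
        (smlProj Sigma.fst (blockPart S₀ a₀ q) (zeroOps L)[(q : ℕ)]) ≤ Cbig
      rw [relRank_smlProj]
      have hmem : (zeroOps L)[(q : ℕ)] ∈ L := mem_of_mem_zeroOps (List.getElem_mem _)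
      refine (hIH _ (hL _ hmem) _ hne).trans ?_
      calc Λ * Phi k p ((blockPart S₀ a₀ q).card : ℝ) ≤ Λ * Phi k p θB := by
            refine mul_le_mul_of_nonneg_left ?_ hΛ0
            exact Phi_antitone k p (by linarith) (hθBA.trans hx)
        _ = ΛΦ := by rw [hE1]
        _ ≤ Cbig := le_mul_of_one_le_left hΛΦ0 (by
            have : (0 : ℝ) ≤ ((s' * (m + 1) ^ m : ℕ) : ℝ) := Nat.cast_nonneg _; linarith)
    · -- a power-sum part: level B
      change relRank K pos (blockPart (T \ S₀) b₀ q)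
        (smlProj Sigma.fst (blockPart (T \ S₀) b₀ q) (newtonPow L (κ.2 q))) ≤ Cbig
      rw [relRank_smlProj]
      have hVm : (blockPart (T \ S₀) b₀ q).card ≤ m :=
        (Finset.card_le_card ((blockPart_subset b₀ q).trans Finset.sdiff_subset))
      have hi : ((κ.2 q : Fin ((T \ S₀).card + 1)) : ℕ) ≤ m := by
        have h1 : ((κ.2 q : Fin ((T \ S₀).card + 1)) : ℕ) < (T \ S₀).card + 1 := (κ.2 q).2
        have h2 : (T \ S₀).card ≤ m := Finset.card_le_card Finset.sdiff_subset
        omega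
      refine (relRank_newtonPow_le hΛ0 hIH L Img hImg hL hLImg hθB1 hθBA hθBk _ hx hVm hi).trans ?_
      rw [hE1, hE2, max_eq_left hΦle]
      have : (0 : ℝ) ≤ ((s' * (m + 1) ^ m : ℕ) : ℝ) := Nat.cast_nonneg _
      nlinarith
  have key := relRank_prod_partition_le Part Fac hdisj hsml hθAk hbig
  rw [hcover, hsum, hE3] at key
  rw [hgen]
  refine key.trans ?_
  rw [max_eq_left (hΦle.trans (le_mul_of_one_le_left hΛΦ0 (by
    have : (0 : ℝ) ≤ ((s' * (m + 1) ^ m : ℕ) : ℝ) := Nat.cast_nonneg _; linarith)))]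
  refine mul_le_mul_of_nonneg_right ?_ hΛΦ0
  have : ((s' * (m + 1) ^ m : ℕ) : ℝ) + 1 ≤ (((s' + 1) * (m + 1) ^ m : ℕ) : ℝ) := by
    have h1 : 1 ≤ (m + 1) ^ m := Nat.one_le_pow _ _ (Nat.succ_pos m)
    exact_mod_cast (by nlinarith : s' * (m + 1) ^ m + 1 ≤ (s' + 1) * (m + 1) ^ m)
  exact this

omit hg in
open Classical in
/-- **The product-gate step** (LST 2025, Prop. 9 + Claim 16 on one product gate): if `IH p`
holds with constant `Λ ≥ 1` and `10 d ≤ k`, then every product gate of product-depth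
`≤ p + 1` satisfies `relrk_{w|T} ≤ (s+N+1)(d+1)^{5d+1} Λ Φ_{p+1}(#T)`.
[cite: LimayeSrinivasanTavenas2025, Claim 16] -/
theorem relRank_prodGate_le [CharZero K] {p : ℕ} {Λ : ℝ} (hΛ : 1 ≤ Λ) (hIH : IHolds k pos g P p Λ)
    (hk : 10 * d ≤ k) {j : ℕ} {args : List (ArithCircuit.Operand K σ₀)}
    (hj : P.gates[j]? = some (.prod args)) (hpd : P.gatePD j ≤ p + 1)
    {T : Finset (Fin d)} (hT : T.Nonempty) :
    relRank K pos T (aeval g (P.gateVal j)) ≤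
      ((P.size + Fintype.card σ₀ + 1) * (d + 1) ^ (5 * d + 1) : ℕ) * (Λ * Phi k (p + 1) T.card) := by
  set m := T.card with hm
  have hm1 : 1 ≤ m := Finset.card_pos.2 hT
  have hmd : m ≤ d := by simpa using Finset.card_le_univ T
  have hΛ0 : 0 ≤ Λ := by linarith
  have hjs : j < P.size := (List.getElem?_eq_some_iff.1 hj).1
  -- the operand values
  set L := args.map fun u => aeval g (P.opVal j u) with hLdef
  have hval : aeval g (P.gateVal j) = L.prod := by
    rw [P.gateVal_of_prod hj, map_list_prod, List.map_map]
    rfl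
  have hL : ∀ x ∈ L, InL k pos g P p x := by
    intro x hx
    obtain ⟨u, hu, rfl⟩ := List.mem_map.1 hx
    refine (inL_opVal j u).mono ?_
    have := P.opPD_succ_le_gatePD_of_prod hj hu
    omega
  set Img : Finset (MvPolynomial (Σ i : Fin d, BlockVar k pos i) K) :=
    (Finset.range P.size).image (fun j' => aeval g (P.gateVal j')) ∪ Finset.univ.image g
  have hImg : Img.card ≤ P.size + Fintype.card σ₀ := by
    refine (Finset.card_union_le _ _).trans (add_le_add ?_ ?_)
    · exact Finset.card_image_le.trans (by simp)
    · exact Finset.card_image_le.trans (by simp)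
  have hLImg : ∀ x ∈ L, x ∈ Img ∨ ∃ c : K, x = C c := by
    intro x hx
    obtain ⟨u, hu, rfl⟩ := List.mem_map.1 hx
    cases u with
    | var v => exact Or.inl (Finset.mem_union_right _ (Finset.mem_image.2 ⟨v, Finset.mem_univ _, by simp⟩))
    | const c => exact Or.inr ⟨c, by simp [MvPolynomial.algebraMap_eq]⟩
    | gate j' =>
      simp only [ArithCircuit.opVal_gate]
      split_ifs with h
      · exact Or.inl (Finset.mem_union_left _
          (Finset.mem_image.2 ⟨j', Finset.mem_range.2 (h.trans hjs), rfl⟩))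
      · exact Or.inr ⟨0, by simp⟩
  rw [hval, ← relRank_smlProj pos T]
  by_cases hz : T.card < (zeroOps L).length
  · rw [smlProj_list_prod_eq_zero_of_card_lt_zeroOps _ L hz, relRank_zero]
    exact mul_nonneg (Nat.cast_nonneg _) (mul_nonneg hΛ0 (Phi_pos k _ _).le)
  · have hspan := smlProj_list_prod_mem_span_newtonGen (Sigma.fst : (Σ i : Fin d, BlockVar k pos i) → Fin d) L T
    refine (relRank_le_sum_of_mem_span pos T hspan).trans ?_
    have hgen := relRank_newtonGen_le hΛ hIH hk L Img hImg hL hLImg T hT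
    calc ∑ gi : NewtonIdx L T, relRank K pos T (newtonGen Sigma.fst L T gi)
        ≤ ∑ _gi : NewtonIdx L T, (((P.size + Fintype.card σ₀ + 1) * (m + 1) ^ m : ℕ) : ℝ) *
            (Λ * Phi k (p + 1) m) := Finset.sum_le_sum fun gi _ => hgen gi
      _ = (Fintype.card (NewtonIdx L T)) *
            ((((P.size + Fintype.card σ₀ + 1) * (m + 1) ^ m : ℕ) : ℝ) * (Λ * Phi k (p + 1) m)) := by
          rw [Finset.sum_const, Finset.card_univ, nsmul_eq_mul]
      _ ≤ ((m + 1) ^ (4 * m + 1) : ℕ) *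
            ((((P.size + Fintype.card σ₀ + 1) * (m + 1) ^ m : ℕ) : ℝ) * (Λ * Phi k (p + 1) m)) := by
          refine mul_le_mul_of_nonneg_right ?_
            (mul_nonneg (Nat.cast_nonneg _) (mul_nonneg hΛ0 (Phi_pos k _ _).le))
          exact_mod_cast card_newtonIdx_le L T (not_lt.1 hz)
      _ = (((P.size + Fintype.card σ₀ + 1) * (m + 1) ^ (5 * m + 1) : ℕ) : ℝ) *
            (Λ * Phi k (p + 1) m) := by
          push_cast; ring
      _ ≤ _ := by
          refine mul_le_mul_of_nonneg_right ?_ (mul_nonneg hΛ0 (Phi_pos k _ _).le)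
          have : (m + 1) ^ (5 * m + 1) ≤ (d + 1) ^ (5 * d + 1) :=
            (Nat.pow_le_pow_left (by omega) _).trans (Nat.pow_le_pow_right (by omega) (by omega))
          exact_mod_cast Nat.mul_le_mul_left _ this

/-- The growth factor of the constants from one product-depth to the next:
`(s+1)(s+N+1)(d+1)^{5d+1} + N + 1`. [cite: LimayeSrinivasanTavenas2025, Claim 16] -/
def stepConst (s N d : ℕ) : ℕ := (s + 1) * (s + N + 1) * (d + 1) ^ (5 * d + 1) + N + 1

/-- The constants `Λ_p`: `Λ_0 = N + 1`, `Λ_{p+1} = stepConst · Λ_p`.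
[cite: LimayeSrinivasanTavenas2025, Claim 16] -/
def Lam (s N d : ℕ) : ℕ → ℝ
  | 0 => N + 1
  | p + 1 => stepConst s N d * Lam s N d p

omit hg in
/-- `Λ_p ≥ 1`. [folklore] -/
theorem one_le_Lam (s N d p : ℕ) : 1 ≤ Lam s N d p := by
  induction p with
  | zero => simp only [Lam]; have : (0 : ℝ) ≤ N := Nat.cast_nonneg N; linarith
  | succ p ih =>
    simp only [Lam]
    have h1 : (1 : ℝ) ≤ stepConst s N d := by
      have : 1 ≤ stepConst s N d := by unfold stepConst; omega
      exact_mod_cast this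
    nlinarith

omit hg in
/-- `Λ_p = stepConst^p (N + 1)`. [folklore] -/
theorem Lam_eq (s N d p : ℕ) : Lam s N d p = (stepConst s N d : ℝ) ^ p * (N + 1) := by
  induction p with
  | zero => simp [Lam]
  | succ p ih => simp only [Lam, ih, pow_succ]; ring

/-- **The induction step** (LST 2025, Claim 16, induction on the product-depth): `IH p` with
`Λ ≥ 1` implies `IH (p+1)` with `stepConst · Λ`, provided `10 d ≤ k`.
[cite: LimayeSrinivasanTavenas2025, Claim 16] -/
theorem iholds_succ [CharZero K] {p : ℕ} {Λ : ℝ} (hΛ : 1 ≤ Λ) (hIH : IHolds k pos g P p Λ)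
    (hk : 10 * d ≤ k) :
    IHolds k pos g P (p + 1) (stepConst P.size (Fintype.card σ₀) d * Λ) := by
  intro x hx T hT
  have hd : 1 ≤ d := by
    have h1 := Finset.card_pos.2 hT
    have h2 : T.card ≤ d := by simpa using Finset.card_le_univ T
    omega
  have hk' : 10 ≤ k := le_trans (by omega) hk
  have hΛ0 : 0 ≤ Λ := by linarith
  have hbase : Phi k (p + 1) T.card ≤ stepConst P.size (Fintype.card σ₀) d * Λ * Phi k (p + 1) T.card := by
    refine le_mul_of_one_le_left (Phi_pos k _ _).le ?_
    have h1 : (1 : ℝ) ≤ stepConst P.size (Fintype.card σ₀) d := by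
      have : 1 ≤ stepConst P.size (Fintype.card σ₀) d := by unfold stepConst; omega
      exact_mod_cast this
    nlinarith
  rcases hx with ⟨j, hj, rfl⟩ | ⟨v, rfl⟩ | ⟨c, rfl⟩
  · set B : ℝ := (((P.size + Fintype.card σ₀ + 1) * (d + 1) ^ (5 * d + 1) : ℕ) : ℝ) * Λ with hB
    have hB0 : 0 ≤ B := mul_nonneg (Nat.cast_nonneg _) hΛ0
    have h := relRank_gate_le_of_prod_le hg hk' (p + 1) hB0
      (fun j' args hargs hpd T' hT' => by
        have := relRank_prodGate_le hΛ hIH hk hargs hpd hT'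
        rwa [← mul_assoc] at this) j hj hT
    refine h.trans (mul_le_mul_of_nonneg_right ?_ (Phi_pos k _ _).le)
    rw [hB, stepConst]
    push_cast
    set A : ℝ := ((P.size : ℝ) + (Fintype.card σ₀ : ℝ) + 1) * ((d : ℝ) + 1) ^ (5 * d + 1) with hA
    have hA0 : 0 ≤ A := by positivity
    have h1 : 0 ≤ A * Λ := mul_nonneg hA0 hΛ0
    have h2 : (Fintype.card σ₀ : ℝ) ≤ ((Fintype.card σ₀ : ℝ) + 1) * Λ := by
      have : (0 : ℝ) ≤ Fintype.card σ₀ := Nat.cast_nonneg _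
      nlinarith
    have hlhs : (P.size : ℝ) * (((P.size : ℝ) + (Fintype.card σ₀ : ℝ) + 1) *
        ((d : ℝ) + 1) ^ (5 * d + 1) * Λ) = P.size * (A * Λ) := by rw [hA]
    have hrhs : (((P.size : ℝ) + 1) * ((P.size : ℝ) + (Fintype.card σ₀ : ℝ) + 1) *
        ((d : ℝ) + 1) ^ (5 * d + 1) + (Fintype.card σ₀ : ℝ) + 1) * Λ =
        P.size * (A * Λ) + A * Λ + ((Fintype.card σ₀ : ℝ) + 1) * Λ := by rw [hA]; ring
    rw [hlhs, hrhs]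
    linarith
  · exact (relRank_var_le hg hk' (p + 1) v T).trans hbase
  · exact (relRank_const_le (p + 1) c hT).trans hbase

/-- **`IH p` holds for every `p`** with the constants `Λ_p` (LST 2025, Claim 16 by induction on
the product-depth). [cite: LimayeSrinivasanTavenas2025, Claim 16] -/
theorem iholds_Lam [CharZero K] (hk : 10 * d ≤ k) (hd : 1 ≤ d) (p : ℕ) :
    IHolds k pos g P p (Lam P.size (Fintype.card σ₀) d p) := by
  induction p with
  | zero =>
    simp only [Lam]
    exact iholds_zero hg (le_trans (by omega) hk)
  | succ p ih =>
    simp only [Lam]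
    exact iholds_succ hg (one_le_Lam _ _ _ _) ih hk

/-- **Main theorem** (semantic form of LST 2025, Lemma 15 / Claim 16 combined with Prop. 9): for
a block-preserving substitution `g` of the variables of a circuit `P` of product-depth `≤ Δ`
(`s` gates, `N` variables) by block-linear forms on the word blocks, and `10 d ≤ k`, `d ≥ 1`:
`relrk_w(g(P)) ≤ Λ_Δ · 2^{-k d^{μ_Δ}/20}` with `Λ_Δ = stepConst(s,N,d)^Δ (N+1)`.
[cite: LimayeSrinivasanTavenas2025, Lemma 15] -/
theorem relRank_aeval_eval_le [CharZero K] (hk : 10 * d ≤ k) (hd : 1 ≤ d) {Δ : ℕ}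
    (hΔ : P.productDepth ≤ Δ) :
    relRank K pos Finset.univ (aeval g P.eval) ≤
      Lam P.size (Fintype.card σ₀) d Δ * Phi k Δ d := by
  have hx : InL k pos g P Δ (aeval g P.eval) := by
    rw [P.eval_eq_opVal_output]
    refine (inL_opVal P.size P.output).mono ?_
    rwa [← P.productDepth_eq_opPD_output]
  have huniv : (Finset.univ : Finset (Fin d)).Nonempty :=
    Finset.univ_nonempty_iff.2 ⟨⟨0, hd⟩⟩
  have h := iholds_Lam hg hk hd Δ _ hx Finset.univ huniv
  rwa [Finset.card_univ, Fintype.card_fin] at h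

end Induction

end LSTWord

end Literature.Computability.AlgebraicComplexity
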